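import Literature.AnabelianGeometry.EtaleTheta.SettingModelChiKummerDataNondeg
import HarnessLib

/-!
# The χ-twisted root model of [EtTh] §1 (R78 (B)): `log(U) ∉ F²`, `log(Ü) ∉ F̈²` in `KummerData.modelχ`

Mochizuki, *The étale theta function …*, Publ. RIMS **45** (2009) [EtTh], §1, Prop. 1.5 (i)(ii), PRIMS PDF p. 23
[cite: MochizukiEtTh2009, Prop 1.5 p.23]: the Leray–Serre filtration `0 ⊆ F² ⊆ F¹ ⊆ F⁰ = H¹((Π^tp_Y)^Θ, Δ_Θ)` has
`F² = H¹(G_K, Δ_Θ) ⥲ H¹(G_K, Ẑ(1)) ⥲ (K^×)^∧` (the Kummer classes of CONSTANTS) and `F¹/F² = Ẑ · log(U)`; likewise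
`F̈² ⥲ (K̈^×)^∧`, `F̈¹/F̈² = Ẑ · log(Ü)`.  So the coordinate classes are NOT Kummer classes of constants.

PROOF-ONLY sequel (abc-iut cell; node EtTh:Prop1.5(i)(ii), NON-VACUITY evidence at abc-iut-L2-t1's χ-twisted root
model `ThetaSetting.modelχ p`; filed by abc-iut-w5-d181 on the GO of the F6 author abc-iut-w5-d171, STATUS
2026-08-26T10:02:40Z) of `SettingModelChiKummerData.lean` / `…Nondeg.lean`: in `SettingModel.kummerDataχ p`

* `SettingModel.kummerCocycle_eq_one_of_right_eq_one` — the Kummer cocycle of an invariant constant VANISHES at every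
  geometric element `toTheta x`, `x.right = 1` (its Galois part `aug x` is trivial);
* `SettingModel.kumY_ne_logUχ`, `SettingModel.logUχ_not_mem_range_kumY` — **`log(U) ∉ F² = Im(kumY)`**: a Kummer
  class of a constant and a coboundary both vanish at the geometric element `b ∈ Δ^tp_Y`, while `log(U)(b) = c ≠ 1`;
* `SettingModel.kumYdd_ne_logUddχ`, `SettingModel.logUddχ_not_mem_range_kumYdd` — **`log(Ü) ∉ F̈² = Im(kumYdd)`**
  (same at `b² ∈ Δ^tp_Ÿ`, where `log(Ü)(b²) = c^{2/2} = c`).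

Together with `SettingModel.logUχ_ne_one` / `res_deltaTheta_logUχ` (abc-iut-w5-d171) this places `log(U)` in `F¹ ∖ F²`
at the χ-model, the slot print assigns to it.  HONEST FRAMING: SEMI-SYNTHETIC model (split-Tate: the longitude is
Galois-fixed), consistency/non-vacuity evidence for the typed interface `ThetaSetting.KummerData` only; nothing of
[EtTh] is asserted; no side is taken on [IUTchIII] Cor. 3.12.  No definitions, no new Prop facts.
-/

noncomputable section

open Topology

namespace Literature.AnabelianGeometry.EtaleTheta.SettingModel

open Literature.AnabelianGeometry.SemiGraphs

variable (p : ℕ) [Fact p.Prime]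

/-! ### Kummer cocycles of constants vanish at geometric elements -/

/-- **The Kummer cocycle of a constant vanishes on `Δ^tp_X`.**  For a subgroup `H ≤ (Π^tp_X)^Θ` of the χ-model, an
`H`-invariant unit `a ∈ ℚ̄_p^×` (for the action through `aug^Θ`) with a compatible root system `r`, and a geometric
element `x ∈ Π^tp_X` (`x.right = 1`) whose image lies in `H`: the Kummer cocycle `(x · r_n / r_n)_n` of `a` at
`toTheta x` is trivial — `x` acts on `ℚ̄_p` through `aug x = 1`.  (Print: `F² = H¹(G_K, Δ_Θ)` is INFLATED from the
Galois group.) [cite: MochizukiEtTh2009, Prop 1.5 p.23] -/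
theorem kummerCocycle_eq_one_of_right_eq_one (H : Subgroup (ThetaSetting.modelχ p).GtpTheta)
    {a : (PadicAlgCl p)ˣ} (r : RootSystem a)
    (ha : letI := (ThetaSetting.modelχ p).unitsAction (kummerCoreχ p).augTheta
      a ∈ MulAction.fixedPoints H (PadicAlgCl p)ˣ)
    {x : PiTpχ p} (hx : x.right = 1) (hxH : CurveTheta.toTheta (curveχ p) x ∈ H) :
    letI := (ThetaSetting.modelχ p).unitsAction (kummerCoreχ p).augTheta
    r.kummerCocycle ha ⟨_, hxH⟩ = 1 := by
  letI := (ThetaSetting.modelχ p).unitsAction (kummerCoreχ p).augTheta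
  refine Subtype.ext (funext fun n => ?_)
  rw [RootSystem.kummerCocycle_apply]
  have haug : CurveTheta.augTheta (curveχ p) (CurveTheta.toTheta (curveχ p) x) = 1 := by
    rw [CurveTheta.augTheta_toTheta]
    exact hx
  have hsm : ((⟨_, hxH⟩ : H) • r.root n) = r.root n := by
    change (CurveTheta.augTheta (curveχ p) (CurveTheta.toTheta (curveχ p) x)) • r.root n = r.root n
    rw [haug, one_smul]
  rw [hsm, div_self']
  rfl

/-! ### `log(U) ∉ F²` -/

/-- **No constant `u ∈ K^×` has Kummer class `log(U)`** in `H¹((Π^tp_Y)^Θ, Δ_Θ)` at the χ-model: evaluate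
representing cocycles at the geometric element `b = (b, 0) ⋊ 1 ∈ Π^tp_Y` — the Kummer cocycle of `u` and every
coboundary vanish there (`aug b = 1`; `Δ^tp_X` centralises `Δ_Θ`), but the `y`-coordinate cocycle gives `c^{ŷ(b)} = c ≠ 1`.
[cite: MochizukiEtTh2009, Prop 1.5 p.23] -/
theorem kumY_ne_logUχ (u : (kummerCoreχ p).invY) : (kummerDataχ p).kumY u ≠ logUχ p := by
  letI := (ThetaSetting.modelχ p).unitsAction (kummerCoreχ p).augTheta
  intro hu
  rw [kummerDataχ_kumY, CyclotomeCoefficients.kummerContMap_apply_eq _ _ _ u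
    (RootSystem.ofRootableBy (u : (PadicAlgCl p)ˣ)), CyclotomeCoefficients.kummerContClass, logUχ,
    ContH1.mk_eq_mk_iff] at hu
  obtain ⟨a, ha⟩ := hu
  set x : PiTpχ p := SemidirectProduct.inl (bPowGfp (iotaZ (Multiplicative.ofAdd 1))) with hxdef
  have hx : CurveTheta.toTheta (curveχ p) x ∈ (ThetaSetting.modelχ p).GtpY.map (ThetaSetting.modelχ p).toTheta :=
    ⟨x, inl_bPowGfp_mem_gtpY p _, rfl⟩
  have h1 := ha ⟨_, hx⟩
  have hc := conjNormal_toTheta_eq_self p (x := x) (SemidirectProduct.right_inl _) a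
  have hcoe : ((⟨_, hx⟩ : ↥((ThetaSetting.modelχ p).GtpY.map (ThetaSetting.modelχ p).toTheta)) :
      (ThetaSetting.modelχ p).GtpTheta) = CurveTheta.toTheta (curveχ p) x := rfl
  rw [MonoidHom.id_apply, hcoe, hc, mul_inv_cancel,
    kummerCocycle_eq_one_of_right_eq_one p _ _ u.2 (SemidirectProduct.right_inl _) hx, map_one, inv_one,
    one_mul] at h1
  -- h1 : logUFunχ p _ ⟨toTheta x, hx⟩ = 1, i.e. `c^{ŷ(b)} = c = 1`
  have h2 : deltaThetaCoordχ p (iotaZ (Multiplicative.ofAdd 1)) = 1 := by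
    rw [← yCoordχ_inl_bPowGfp p (iotaZ (Multiplicative.ofAdd 1))]
    exact h1
  have h3 := (bijective_deltaThetaCoordχ p).1 (h2.trans (map_one (deltaThetaCoordχ p)).symm)
  exact iotaZ_ofAdd_ne_one one_ne_zero h3

/-- **`log(U) ∉ F²`**: the coordinate class `log(U)` of `KummerData.modelχ` is not in the image of the Kummer map
`kumY : K^× → H¹((Π^tp_Y)^Θ, Δ_Θ)` (print: `F² ⥲ (K^×)^∧`, `F¹/F² = Ẑ · log(U)`). [cite: MochizukiEtTh2009, Prop 1.5 p.23] -/
theorem logUχ_not_mem_range_kumY : logUχ p ∉ Set.range (kummerDataχ p).kumY := by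
  rintro ⟨u, hu⟩
  exact kumY_ne_logUχ p u hu

/-- The same for the record field: `(kummerDataχ p).logU ∉ Im kumY`. [cite: MochizukiEtTh2009, Prop 1.5 p.23] -/
theorem kummerDataχ_logU_not_mem_range_kumY : (kummerDataχ p).logU ∉ Set.range (kummerDataχ p).kumY :=
  logUχ_not_mem_range_kumY p

/-! ### Integer powers: `log(U)^n ∉ F²` for `n ≠ 0` -/

/-- Integer powers of `log(U)` are the classes of the powers of the `y`-coordinate cocycle.
[cite: MochizukiEtTh2009, Prop 1.5 p.23] -/
theorem logUχ_zpow (n : ℤ) :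
    logUχ p ^ n = ContH1.mk (logUFunχ p _ ^ n) (zpow_mem (logUFunχ_mem p _) n) := rfl

/-- **No non-zero integer power of `log(U)` is the Kummer class of a constant** (`log(U)^ℤ ∩ F² = 1`; print:
`F¹/F² = Ẑ · log(U)` is free over `F²`): at `b` the cocycle of `log(U)^n` takes the value `c^n ≠ 1`.
[cite: MochizukiEtTh2009, Prop 1.5 p.23] -/
theorem kumY_ne_logUχ_zpow (u : (kummerCoreχ p).invY) {n : ℤ} (hn : n ≠ 0) :
    (kummerDataχ p).kumY u ≠ logUχ p ^ n := by
  letI := (ThetaSetting.modelχ p).unitsAction (kummerCoreχ p).augTheta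
  intro hu
  rw [kummerDataχ_kumY, CyclotomeCoefficients.kummerContMap_apply_eq _ _ _ u
    (RootSystem.ofRootableBy (u : (PadicAlgCl p)ˣ)), CyclotomeCoefficients.kummerContClass, logUχ_zpow] at hu
  obtain ⟨a, ha⟩ := (ContH1.mk_eq_mk_iff _ _ _ _ _).mp hu
  set x : PiTpχ p := SemidirectProduct.inl (bPowGfp (iotaZ (Multiplicative.ofAdd 1))) with hxdef
  have hx : CurveTheta.toTheta (curveχ p) x ∈ (ThetaSetting.modelχ p).GtpY.map (ThetaSetting.modelχ p).toTheta :=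
    ⟨x, inl_bPowGfp_mem_gtpY p _, rfl⟩
  have h1 := ha ⟨_, hx⟩
  have hc := conjNormal_toTheta_eq_self p (x := x) (SemidirectProduct.right_inl _) a
  have hcoe : ((⟨_, hx⟩ : ↥((ThetaSetting.modelχ p).GtpY.map (ThetaSetting.modelχ p).toTheta)) :
      (ThetaSetting.modelχ p).GtpTheta) = CurveTheta.toTheta (curveχ p) x := rfl
  rw [MonoidHom.id_apply, hcoe, hc, mul_inv_cancel,
    kummerCocycle_eq_one_of_right_eq_one p _ _ u.2 (SemidirectProduct.right_inl _) hx, map_one, inv_one,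
    one_mul, Pi.pow_apply] at h1
  -- h1 : (logUFunχ p _ ⟨toTheta x, hx⟩) ^ n = 1, i.e. `c^{n·ŷ(b)} = c^n = 1`
  have h2 : deltaThetaCoordχ p (iotaZ (Multiplicative.ofAdd 1) ^ n) = 1 := by
    rw [map_zpow, ← yCoordχ_inl_bPowGfp p (iotaZ (Multiplicative.ofAdd 1))]
    exact h1
  have h3 := (bijective_deltaThetaCoordχ p).1 (h2.trans (map_one (deltaThetaCoordχ p)).symm)
  rw [← map_zpow, ← ofAdd_zsmul, smul_eq_mul, mul_one] at h3
  exact iotaZ_ofAdd_ne_one hn h3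

/-- Hence the cyclic subgroup generated by `log(U)` meets `F² = Im(kumY)` trivially.
[cite: MochizukiEtTh2009, Prop 1.5 p.23] -/
theorem zpowers_logUχ_inf_range_kumY :
    Subgroup.zpowers (logUχ p) ⊓ (kummerDataχ p).kumY.range = ⊥ := by
  refine (Subgroup.eq_bot_iff_forall _).mpr fun z hz => ?_
  obtain ⟨hz1, hz2⟩ := Subgroup.mem_inf.mp hz
  obtain ⟨n, rfl⟩ := Subgroup.mem_zpowers_iff.mp hz1
  obtain ⟨u, hu⟩ := hz2
  by_cases hn : n = 0
  · rw [hn, zpow_zero]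
  · exact absurd hu (kumY_ne_logUχ_zpow p u hn)

/-! ### `log(Ü) ∉ F̈²` -/

/-- The Kummer map `kumYdd` of `KummerData.modelχ` IS the tree's continuous Kummer map on `(Π^tp_Ÿ)^Θ`
(companion of `kummerDataχ_kumY`). [cite: MochizukiEtTh2009, Prop 1.5 p.23] -/
theorem kummerDataχ_kumYdd (x : (kummerCoreχ p).invYdd) :
    (kummerDataχ p).kumYdd x =
      (letI := (ThetaSetting.modelχ p).unitsAction (kummerCoreχ p).augTheta
       (kummerCoreχ p).coeff.kummerContMap _ (kummerCoreχ p).isOpen_stabilizer' x) :=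
  rfl

/-- **No constant `u ∈ K̈^×` has Kummer class `log(Ü)`** in `H¹((Π^tp_Ÿ)^Θ, Δ_Θ)` at the χ-model: at the geometric
element `b² ∈ Π^tp_Ÿ` the Kummer cocycle of `u` and every coboundary vanish, but `log(Ü)(b²) = c^{2/2} = c ≠ 1`.
[cite: MochizukiEtTh2009, Prop 1.5 p.23] -/
theorem kumYdd_ne_logUddχ (u : (kummerCoreχ p).invYdd) : (kummerDataχ p).kumYdd u ≠ logUddχ p := by
  letI := (ThetaSetting.modelχ p).unitsAction (kummerCoreχ p).augTheta
  intro hu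
  rw [kummerDataχ_kumYdd, CyclotomeCoefficients.kummerContMap_apply_eq _ _ _ u
    (RootSystem.ofRootableBy (u : (PadicAlgCl p)ˣ)), CyclotomeCoefficients.kummerContClass, logUddχ,
    ContH1.mk_eq_mk_iff] at hu
  obtain ⟨a, ha⟩ := hu
  set x : PiTpχ p := SemidirectProduct.inl (bPowGfp (iotaZ (Multiplicative.ofAdd 2))) with hxdef
  have hx : CurveTheta.toTheta (curveχ p) x ∈
      (ThetaSetting.modelχ p).GtpYdd.map (ThetaSetting.modelχ p).toTheta :=
    ⟨x, inl_bPowGfp_two_mem_gtpYdd p, rfl⟩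
  have h1 := ha ⟨_, hx⟩
  have hc := conjNormal_toTheta_eq_self p (x := x) (SemidirectProduct.right_inl _) a
  have hcoe : ((⟨_, hx⟩ : ↥((ThetaSetting.modelχ p).GtpYdd.map (ThetaSetting.modelχ p).toTheta)) :
      (ThetaSetting.modelχ p).GtpTheta) = CurveTheta.toTheta (curveχ p) x := rfl
  rw [MonoidHom.id_apply, hcoe, hc, mul_inv_cancel,
    kummerCocycle_eq_one_of_right_eq_one p _ _ u.2 (SemidirectProduct.right_inl _) hx, map_one, inv_one,
    one_mul] at h1
  -- h1 : logUddFunχ p ⟨toTheta x, hx⟩ = 1, i.e. `c^{half ŷ(b²)} = 1` ⇒ `half (ι 2) = 1` ⇒ `ι 2 = 1`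
  have h2 : half ⟨yThetaχ p (CurveTheta.toTheta (curveχ p) x), yThetaχ_mem_range_sqHom p hx⟩ = 1 :=
    (bijective_deltaThetaCoordχ p).1 (h1.trans (map_one (deltaThetaCoordχ p)).symm)
  have h3 := half_sq ⟨yThetaχ p (CurveTheta.toTheta (curveχ p) x), yThetaχ_mem_range_sqHom p hx⟩
  rw [h2, one_pow] at h3
  have h4 : yThetaχ p (CurveTheta.toTheta (curveχ p) x) = iotaZ (Multiplicative.ofAdd 2) := by
    rw [yThetaχ_toTheta]
    exact yCoordχ_inl_bPowGfp p _
  exact iotaZ_ofAdd_ne_one two_ne_zero (h4.symm.trans h3.symm)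

/-- **`log(Ü) ∉ F̈²`**: `log(Ü)` is not in the image of `kumYdd : K̈^× → H¹((Π^tp_Ÿ)^Θ, Δ_Θ)` (print:
`F̈² ⥲ (K̈^×)^∧`, `F̈¹/F̈² = Ẑ · log(Ü)`). [cite: MochizukiEtTh2009, Prop 1.5 p.23] -/
theorem logUddχ_not_mem_range_kumYdd : logUddχ p ∉ Set.range (kummerDataχ p).kumYdd := by
  rintro ⟨u, hu⟩
  exact kumYdd_ne_logUddχ p u hu

/-- The same for the record field: `(kummerDataχ p).logUdd ∉ Im kumYdd`. [cite: MochizukiEtTh2009, Prop 1.5 p.23] -/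
theorem kummerDataχ_logUdd_not_mem_range_kumYdd :
    (kummerDataχ p).logUdd ∉ Set.range (kummerDataχ p).kumYdd :=
  logUddχ_not_mem_range_kumYdd p

end Literature.AnabelianGeometry.EtaleTheta.SettingModel

end
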